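import Literature.NumberTheory.NumberFields.PlacesAboveDoubleCosets
import Literature.NumberTheory.GaloisRepresentations.IdeleClassBarSRelativeInvariant
import Literature.NumberTheory.GaloisRepresentations.IdeleTruncatedSLocalization
import Literature.NumberTheory.GaloisRepresentations.CompletionCompositumEmbedding
import Literature.NumberTheory.GaloisRepresentations.GalLayerSystemIdele
import Literature.NumberTheory.GaloisRepresentations.LocalLayerTwistedRestriction
import HarnessLib

/-!
# The local components `(v, t)`, `t ∈ U\G_S/φ_v(Γ_{K_v})`, exhaust the places of the fixed field `K_S^{U}|_E`
# above `v`: every `u ∣ v` of `E^{H_E}` is `(s_t|_E · w̄_E)|_{E^{H_E}}` (Neukirch I §9; Cassels–Fröhlich VII §1.1)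

Topic `NumberTheory/GaloisRepresentations`; namespace `Literature.NumberTheory.GaloisRepresentations.IdeleReadout`.
Theorems and ONE definition with body (§3 `dcLocPlacesEquiv`); no named fact, no instance, no notation, no `sorry`;
number fields in `Type`.
The instantiation, in the currency of lane «PT-Ш-S-TC» (crux `GoodLatticeBDPValue`, stmt-BirchSwinnertonDyer-19032,
cell bsd-eis), of bsd-line-x1-p1-w7's `PlacesDoubleCosets.exists_under_dcRep_smul_eq` («every place of `E^H` above `v`
is `(π(s_t) · x₀)|_{E^H}`»):

* `Γ := G_S = Γ_K ⧸ N_S`, `φ := φ_v = decompMapPlaceS K S (Sum.inr v) : Γ_{K_v} → G_S` (bsd-line-x1-p1-w4's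
  `IdeleTruncatedSLocalization`), `U ≤ G_S` any subgroup (open normal in the application);
* `E : GalLayer K` a finite Galois layer `E ⊆ K̄` with `N_S ≤ Gal(K̄/E)` (`hE`), `π := restrictHomS S hE : G_S ↠ Gal(E/K)`
  (`[σ] ↦ σ|_E`, bsd-line-x1-p1-w3's `IdeleClassBarSRelativeLayers`; onto: `restrictHomS_surjective`),
  `H := H_E = subgroupImageS S hE U = π(U)`, `L := E^{H_E}`;
* `x₀ := w̄_E = SemiLocal.embPlace v E.1.val`, THE place of `E` above `v` cut out by the chosen `K̄ → K̄_v` (door-c6's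
  `CompletionCompositumEmbedding`), which is fixed by `π(φ_v(Γ_{K_v}))` (`SemiLocal.smul_embPlace_eq`).

Results: **`restrictHomS_decompMapPlaceS_smul_embPlace`** (the hypothesis `hφ`: `(res_v d)|_E · w̄_E = w̄_E`),
**`exists_dcRep_smul_embPlace_under_eq`** (for every finite place `u` of `L` above `v` there is a double coset `t` with
`((s_t|_E) · w̄_E)|_L = u`, `s_t = dcRep φ_v U t`) and its `u ∩ 𝓞 K ∈ S` form `exists_dcRep_smul_embPlace_under_eq_of_mem`.
With bsd-line-x1-p1-w3 (gen 19)'s `smul_embPlace_eq_locPlace` (`restrictHomS S hE s • w̄_E = locPlace K S hE v s`, file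
`LocalLayerTwistedRestriction`) this is literally the hypothesis `hu` of their `locPlaceOver K S U hE v (dcRep φ_v U t) u hu` —
§2 **`exists_locPlace_under_eq`** / `exists_locPlace_under_eq_self` state it in that form (`∃ t, ↑(locPlace … (s_t))|_L = u`) — file
P2-b (iii) of brick [P2-mono] for bsd-line-x1-p1-w8's `eq_zero_of_forall_locLayerClass_eq_zero`.  §3 completes the
correspondence to a BIJECTION under `hEU : V̄_E ≤ U` (then `U = π⁻¹(H_E)` and `G_{w̄_E} = π(φ_v(Γ_{K_v}))`, door-c6's
`exists_restrict_of_smul_embPlace_eq`): **`dcLocPlacesEquiv : U\G_S/φ_v(Γ_{K_v}) ≃ {u : place of L | u ∣ v}`**,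
`t ↦ w_{s_t}|_L` (`coe_dcLocPlacesEquiv_apply`), and `natCard_doubleCosets_decompMapPlaceS_eq` — the remark «`T ↔ {w ∣ v}`» of
bsd-line-x1-p1-w4's `DiscreteRepCoindPullbackNormal` made a theorem (one definition with body: the `Equiv`).  HONEST FRAMING: bookkeeping of places; nothing about
Poitou–Tate or BSD is proved here.  AI formalisation, established only by the kernel check.

## References
* J. Neukirch, *Algebraic Number Theory* (1999), Ch. I §9 (p. 54–55), Ch. II (8.1)–(8.3). [NeukirchANT1999]
* J. W. S. Cassels, A. Fröhlich (eds.), *Algebraic Number Theory* (1967), Ch. VII (J. Tate) §1.1, Prop. 1.2 (ii).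
  [CasselsFrohlichANT1967]
* D. Harari, *Galois Cohomology and Class Field Theory*, Universitext (2020), §17.5 Lemma 17.23 (the decomposition
  maps `Γ_{K_v} → G_S`). [Harari2020]
-/

noncomputable section

open NumberField IsDedekindDomain Field
open Literature.NumberTheory.Automorphic Literature.Algebra.Homology.DiscreteRep
open Literature.NumberTheory.NumberFields

namespace Literature.NumberTheory.GaloisRepresentations

namespace IdeleReadout

open IdeleClassBar SemiLocal
open Literature.NumberTheory.GaloisRepresentations.LocalWeilDatum (galFixing)

variable (K : Type) [Field K] [NumberField K] (S : Finset (HeightOneSpectrum (𝓞 K)))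
variable (U : Subgroup (GaloisGroupUnramifiedOutside K (↑S : Set (HeightOneSpectrum (𝓞 K)))))
variable {E : GalLayer K} [IsGalois K E.1] [NumberField E.1]
variable (hE : ramificationSubgroup K (↑S : Set (HeightOneSpectrum (𝓞 K))) ≤ galFixing K E.1)
variable (v : HeightOneSpectrum (𝓞 K))

/-- **`hφ`: the image of `Γ_{K_v} → G_S → Gal(E/K)` fixes the distinguished place `w̄_E = embPlace v (E ⊆ K̄)`**
(`(res_v d)|_E ∈ G_{w̄_E}`; door-c6's `smul_embPlace_eq` with `hg` = «`(σ|_E)(e) = σ(e)` in `K̄`»).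
[cite: CasselsFrohlichANT1967, Ch. VII §1.1][cite: Harari2020, §17.5 Lemma 17.23] -/
theorem restrictHomS_decompMapPlaceS_smul_embPlace
    (d : absoluteGaloisGroup (Place.Completion (Sum.inr v : Place K))) :
    restrictHomS S hE (decompMapPlaceS K S (Sum.inr v) d) • embPlace v E.1.val = embPlace v E.1.val := by
  rw [decompMapPlaceS_apply, restrictHomS_mk]
  refine smul_embPlace_eq v E.1.val (d := d) fun e => ?_
  change ((E.restrictHom _ e : E.1) : AlgebraicClosure K) = _
  rw [GalLayer.coe_restrictHom_apply]
  rfl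

/-- **Every finite place `u` of `L = E^{H_E}` above `v` is `((s_t|_E) · w̄_E)|_L` for some double coset
`t ∈ U\G_S/φ_v(Γ_{K_v})`** (`s_t = dcRep φ_v U t`, `H_E = subgroupImageS S hE U`): bsd-line-x1-p1-w7's
`PlacesDoubleCosets.exists_under_dcRep_smul_eq` at `π := restrictHomS S hE` (onto), `x₀ := w̄_E`, `hφ` as above.
[cite: NeukirchANT1999, Ch. I §9 (p. 54–55)][cite: CasselsFrohlichANT1967, Ch. VII Prop. 1.2 (ii)] -/
theorem exists_dcRep_smul_embPlace_under_eq
    (u : HeightOneSpectrum (𝓞 (IntermediateField.fixedField (subgroupImageS S hE U))))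
    (hu : u.under (𝓞 K) = v) :
    ∃ t : DoubleCosets (decompMapPlaceS K S (Sum.inr v)) U,
      ((restrictHomS S hE (dcRep (decompMapPlaceS K S (Sum.inr v)) U t) • embPlace v E.1.val :
          SemiLocal.Place K E.1 v) : HeightOneSpectrum (𝓞 E.1)).under
        (𝓞 (IntermediateField.fixedField (subgroupImageS S hE U))) = u :=
  PlacesDoubleCosets.exists_under_dcRep_smul_eq (decompMapPlaceS K S (Sum.inr v)) U (restrictHomS S hE)
    (restrictHomS_surjective S hE) (subgroupImageS S hE U) (fun _ hg => Subgroup.mem_map_of_mem _ hg)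
    (embPlace v E.1.val) (restrictHomS_decompMapPlaceS_smul_embPlace K S hE v) u hu

/-- The same for `u` a finite place of `L = E^{H_E}` above the SET `S` (`v := u ∩ 𝓞 K ∈ S`).
[cite: NeukirchANT1999, Ch. I §9 (p. 54–55)][cite: CasselsFrohlichANT1967, Ch. VII Prop. 1.2 (ii)] -/
theorem exists_dcRep_smul_embPlace_under_eq_self
    (u : HeightOneSpectrum (𝓞 (IntermediateField.fixedField (subgroupImageS S hE U)))) :
    ∃ t : DoubleCosets (decompMapPlaceS K S (Sum.inr (u.under (𝓞 K)))) U,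
      ((restrictHomS S hE (dcRep (decompMapPlaceS K S (Sum.inr (u.under (𝓞 K)))) U t) •
            embPlace (u.under (𝓞 K)) E.1.val :
          SemiLocal.Place K E.1 (u.under (𝓞 K))) : HeightOneSpectrum (𝓞 E.1)).under
        (𝓞 (IntermediateField.fixedField (subgroupImageS S hE U))) = u :=
  exists_dcRep_smul_embPlace_under_eq K S U hE (u.under (𝓞 K)) u rfl

/-! ## §2. The same in the `locPlace` currency of `LocalLayerTwistedRestriction` (bsd-line-x1-p1-w3 gen 19) -/

/-- **Every finite place `u` of `L = E^{H_E}` above `v` is `w_{s_t}|_L` for some double coset `t`**, where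
`w_s = locPlace K S hE v s` is the place cut out by the twisted embedding `K̄ →(s⁻¹)→ K̄ → K̄_v` (`= (s|_E) · w̄_E`,
`smul_embPlace_eq_locPlace`): the hypothesis `hu` of `locPlaceOver K S U hE v (dcRep φ_v U t) u hu`.
[cite: NeukirchANT1999, Ch. I §9 (p. 54–55)][cite: CasselsFrohlichANT1967, Ch. VII §1.1, Prop. 1.2 (ii)] -/
theorem exists_locPlace_under_eq
    (u : HeightOneSpectrum (𝓞 (locFixedField K S U hE))) (hu : u.under (𝓞 K) = v) :
    ∃ t : DoubleCosets (decompMapPlaceS K S (Sum.inr v)) U,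
      (locPlace K S hE v (dcRep (decompMapPlaceS K S (Sum.inr v)) U t) : HeightOneSpectrum (𝓞 E.1)).under
        (𝓞 (locFixedField K S U hE)) = u := by
  obtain ⟨t, ht⟩ := exists_dcRep_smul_embPlace_under_eq K S U hE v u hu
  exact ⟨t, by rw [← smul_embPlace_eq_locPlace]; exact ht⟩

/-- The same for `u` a finite place of `L = E^{H_E}` above the SET `S` (`v := u ∩ 𝓞 K`).
[cite: NeukirchANT1999, Ch. I §9 (p. 54–55)][cite: CasselsFrohlichANT1967, Ch. VII Prop. 1.2 (ii)] -/
theorem exists_locPlace_under_eq_self (u : HeightOneSpectrum (𝓞 (locFixedField K S U hE))) :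
    ∃ t : DoubleCosets (decompMapPlaceS K S (Sum.inr (u.under (𝓞 K)))) U,
      (locPlace K S hE (u.under (𝓞 K)) (dcRep (decompMapPlaceS K S (Sum.inr (u.under (𝓞 K)))) U t) :
          HeightOneSpectrum (𝓞 E.1)).under (𝓞 (locFixedField K S U hE)) = u :=
  exists_locPlace_under_eq K S U hE (u.under (𝓞 K)) u rfl

/-! ## §3. Under `V̄_E ≤ U` the correspondence `U\G_S/φ_v(Γ_{K_v}) ↔ {places of L above v}` is a bijection -/

omit [IsGalois K E.1] [NumberField E.1] in
/-- `U = π⁻¹(H_E)` for `π = restrictHomS S hE`, `H_E = π(U)`, as soon as `ker π = V̄_E ≤ U`.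
[cite: CasselsFrohlichANT1967, Ch. VII §1.1] -/
theorem eq_comap_subgroupImageS
    (hEU : (layerSubgroupS S E : Subgroup (GaloisGroupUnramifiedOutside K (↑S : Set (HeightOneSpectrum (𝓞 K))))) ≤ U) :
    U = (subgroupImageS S hE U).comap (restrictHomS S hE) := by
  rw [Subgroup.comap_map_eq, ker_restrictHomS, sup_eq_left.2 hEU]

/-- **`Γ_{K_v} → G_S → Gal(E/K)` maps ONTO the decomposition group `G_{w̄_E}`**: every `g` fixing `w̄_E = embPlace v (E ⊆ K̄)`
is `(res_v d)|_E` for some `d ∈ Γ_{K_v}` (door-c6 `exists_restrict_of_smul_embPlace_eq`).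
[cite: CasselsFrohlichANT1967, Ch. VII §1.1, Prop. 1.2][cite: Harari2020, §17.5 Lemma 17.23] -/
theorem exists_restrictHomS_decompMapPlaceS_eq_of_smul_embPlace {g : E.1 ≃ₐ[K] E.1}
    (hg : g • embPlace v E.1.val = embPlace v E.1.val) :
    ∃ d : absoluteGaloisGroup (Place.Completion (Sum.inr v : Place K)),
      restrictHomS S hE (decompMapPlaceS K S (Sum.inr v) d) = g := by
  obtain ⟨d, hd⟩ := exists_restrict_of_smul_embPlace_eq v E.1.val hg
  refine ⟨d, AlgEquiv.ext fun e => Subtype.ext ?_⟩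
  rw [decompMapPlaceS_apply, restrictHomS_mk, GalLayer.coe_restrictHom_apply]
  exact (hd e).symm

/-- **The bijection `U\G_S/φ_v(Γ_{K_v}) ≃ {places of L = E^{H_E} above v}`, `t ↦ w_{s_t}|_L`** (`V̄_E ≤ U`):
bsd-line-x1-p1-w7's `PlacesDoubleCosets.dcPlacesEquiv` at `π := restrictHomS S hE`, `w̄ := embPlace v (E ⊆ K̄)`.
[cite: NeukirchANT1999, Ch. I §9 (p. 54–55)][cite: CasselsFrohlichANT1967, Ch. VII Prop. 1.2 (ii)] -/
def dcLocPlacesEquiv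
    (hEU : (layerSubgroupS S E : Subgroup (GaloisGroupUnramifiedOutside K (↑S : Set (HeightOneSpectrum (𝓞 K))))) ≤ U) :
    DoubleCosets (decompMapPlaceS K S (Sum.inr v)) U ≃
      {u : HeightOneSpectrum (𝓞 (locFixedField K S U hE)) // u.under (𝓞 K) = v} :=
  PlacesDoubleCosets.dcPlacesEquiv (decompMapPlaceS K S (Sum.inr v)) U (restrictHomS S hE)
    (restrictHomS_surjective S hE) (subgroupImageS S hE U) (eq_comap_subgroupImageS K S U hE hEU)
    (embPlace v E.1.val) (restrictHomS_decompMapPlaceS_smul_embPlace K S hE v)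
    fun _ hg => exists_restrictHomS_decompMapPlaceS_eq_of_smul_embPlace K S hE v hg

/-- Formula: `dcLocPlacesEquiv t = w_{s_t}|_L` with `w_s = locPlace K S hE v s`. [cite: NeukirchANT1999, Ch. I §9 (p. 54–55)] -/
theorem coe_dcLocPlacesEquiv_apply
    (hEU : (layerSubgroupS S E : Subgroup (GaloisGroupUnramifiedOutside K (↑S : Set (HeightOneSpectrum (𝓞 K))))) ≤ U)
    (t : DoubleCosets (decompMapPlaceS K S (Sum.inr v)) U) :
    ((dcLocPlacesEquiv K S U hE v hEU t : {u : HeightOneSpectrum (𝓞 (locFixedField K S U hE)) // u.under (𝓞 K) = v}) :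
        HeightOneSpectrum (𝓞 (locFixedField K S U hE))) =
      (locPlace K S hE v (dcRep (decompMapPlaceS K S (Sum.inr v)) U t) : HeightOneSpectrum (𝓞 E.1)).under
        (𝓞 (locFixedField K S U hE)) := by
  rw [← smul_embPlace_eq_locPlace]
  rfl

/-- **`#(U\G_S/φ_v(Γ_{K_v})) = #{places of L = E^{H_E} above v}`** (`V̄_E ≤ U`). [cite: NeukirchANT1999, Ch. I §9 (p. 54–55)] -/
theorem natCard_doubleCosets_decompMapPlaceS_eq
    (hEU : (layerSubgroupS S E : Subgroup (GaloisGroupUnramifiedOutside K (↑S : Set (HeightOneSpectrum (𝓞 K))))) ≤ U) :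
    Nat.card (DoubleCosets (decompMapPlaceS K S (Sum.inr v)) U) =
      Nat.card {u : HeightOneSpectrum (𝓞 (locFixedField K S U hE)) // u.under (𝓞 K) = v} :=
  Nat.card_congr (dcLocPlacesEquiv K S U hE v hEU)

end IdeleReadout

end Literature.NumberTheory.GaloisRepresentations

end
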